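import Mathlib
import Literature.Geometry.Lorentzian.KerrConvergenceProofs
import Literature.Geometry.Lorentzian.KerrSchildEnergyEstimate
import Summits.FinalStateConjecture.FinalStateConjecture.Theorems.EIHFluxBalanceInertialRecessionLorentz
import Summits.FinalStateConjecture.FinalStateConjecture.Theorems.EIHFluxBalanceModulatedKerrHandoffDragDefectTaylor

/-!
# Route EIHFluxBalance — `ModulatedKerrHandoff`, stub `stub_dragDefect`: geometry of the buffer
# shell and the jets of the two holes there

Helper file for the crux `stmt-FinalStateConjecture-10167`
(`Summit.FinalStateConjecture.FinalStateConjecture.Theses.EIHFluxBalance.ModulatedKerrHandoff`),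
line `overlap-modulation-second-iterate`, stub `stub_dragDefect`. Set-up of the drag-defect estimate
at a slab point `x` (`x⁰ = 0`) on hole 1's buffer shell `‖x̲‖ = d`, `8d ≤ D`, hole 2 at `c₂`,
`‖c₂̲‖ = D`: spatial-norm geometry (`spatialNorm_sub_far`, `spatialNorm_add_drag`, …), the second
derivative of a sum (`fderiv_fderiv_add_of_isOpen`), the jets of hole 2 at `x` with the CANCELLATION
`‖h₂(x) − h₂(0)‖ ≤ 2K d/D²` of its potential against its value at hole 1's centre (`hole₂_jets`, mean
value on `B(0, 2d)`), the jets of hole 1 on `B(x, d/2)` (`hole₁_ball_jets`), the dragged point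
(`drag_point`), and everything at once (`shell_data`). The decay law
`‖Dᵐ(g_{M,0}(· − c) − η)(y)‖ ≤ K/‖(y − c)̲‖^{m+1}` (the shape of `exists_ksPert_jets_le` of
`…DragDefectKSDecay`) is taken as a hypothesis.
-/

noncomputable section

-- `Summit.<S>.<S>.…` (single-problem summit, D-0017) trips core's duplicate-namespace linter.
set_option linter.dupNamespace false
set_option maxSynthPendingDepth 3

open Set Function Filter Metric ContinuousLinearMap Literature.Geometry.Lorentzian
open scoped Topology ContDiff

namespace Summit.FinalStateConjecture.FinalStateConjecture.Theorems

namespace DragDefect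

/-! ### Spatial-norm geometry -/

section Geometry

/-- `‖(−v)̲‖ = ‖v̲‖`, so `‖(a − b)̲‖ = ‖(b − a)̲‖`. [folklore] -/
theorem spatialNorm_sub_comm (a b : E4) : E4.spatialNorm (a - b) = E4.spatialNorm (b - a) := by
  rw [E4.spatialNorm, E4.spatialNorm, ← neg_sub, map_neg, norm_neg]

/-- Spatial triangle inequality `‖a̲‖ ≤ ‖(a − b)̲‖ + ‖b̲‖`. [folklore] -/
theorem spatialNorm_le_spatialNorm_add (a b : E4) :
    E4.spatialNorm a ≤ E4.spatialNorm (a - b) + E4.spatialNorm b := by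
  unfold E4.spatialNorm
  calc ‖E4.spatial a‖ = ‖E4.spatial (a - b) + E4.spatial b‖ := by rw [← map_add, sub_add_cancel]
    _ ≤ _ := norm_add_le _ _

/-- The centre of hole 2, `c₂ = (0, D e)` with `‖e‖ = 1`, `0 ≤ D`, has `‖c₂̲‖ = D`. [folklore] -/
theorem spatialNorm_centre {D : ℝ} (hD : 0 ≤ D) {e : E3} (he : ‖e‖ = 1) :
    E4.spatialNorm (E4.ofTimeSpace 0 (D • e)) = D := by
  rw [E4.spatialNorm_ofTimeSpace, norm_smul, he, mul_one, Real.norm_eq_abs, abs_of_nonneg hD]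

/-- **Points of the ball `B(0, 2d)` are far from hole 2**: `‖(z − c₂)̲‖ ≥ D − 2d`. [folklore] -/
theorem spatialNorm_sub_far {c₂ z : E4} {D d : ℝ} (hc : E4.spatialNorm c₂ = D)
    (hz : ‖z‖ < 2 * d) : D - 2 * d ≤ E4.spatialNorm (z - c₂) := by
  have h1 := spatialNorm_le_spatialNorm_add c₂ z
  rw [spatialNorm_sub_comm] at h1
  linarith [E4.spatialNorm_le_norm z]

/-- **The shell point is far from hole 2**: `‖(x − c₂)̲‖ ≥ D − d`. [folklore] -/
theorem spatialNorm_sub_far' {c₂ x : E4} {D : ℝ} (hc : E4.spatialNorm c₂ = D) :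
    D - E4.spatialNorm x ≤ E4.spatialNorm (x - c₂) := by
  have h1 := spatialNorm_le_spatialNorm_add c₂ x
  rw [spatialNorm_sub_comm] at h1
  linarith

/-- **The dragged point stays off hole 1's axis**: `‖(x + Ax)̲‖ ≥ ‖x̲‖ − ‖Ax‖`. [folklore] -/
theorem spatialNorm_add_drag (x w : E4) : E4.spatialNorm x - ‖w‖ ≤ E4.spatialNorm (x + w) := by
  have h2 := spatialNorm_le_spatialNorm_add x (x + w)
  have h3 : E4.spatialNorm (x - (x + w)) = E4.spatialNorm w := by
    rw [show x - (x + w) = -w by abel, E4.spatialNorm, E4.spatialNorm, map_neg, norm_neg]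
  rw [h3] at h2
  linarith [E4.spatialNorm_le_norm w]

end Geometry

/-! ### Second derivative of a sum -/

/-- Second derivative of a sum of functions that are smooth on an open set. [folklore] -/
theorem fderiv_fderiv_add_of_isOpen {E F : Type*} [NormedAddCommGroup E] [NormedSpace ℝ E]
    [NormedAddCommGroup F] [NormedSpace ℝ F] {f g : E → F} {O : Set E} (hO : IsOpen O)
    (hf : ∀ y ∈ O, ContDiffAt ℝ ∞ f y) (hg : ∀ y ∈ O, ContDiffAt ℝ ∞ g y) {x : E} (hx : x ∈ O) :
    fderiv ℝ (fderiv ℝ (fun y ↦ f y + g y)) x =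
      fderiv ℝ (fderiv ℝ f) x + fderiv ℝ (fderiv ℝ g) x := by
  have hev : fderiv ℝ (fun y ↦ f y + g y) =ᶠ[𝓝 x] fun y ↦ fderiv ℝ f y + fderiv ℝ g y := by
    filter_upwards [hO.mem_nhds hx] with y hy
    exact fderiv_add ((hf y hy).differentiableAt (by simp)) ((hg y hy).differentiableAt (by simp))
  rw [hev.fderiv_eq]
  have h2le : (1 : ℕ∞ω) + 1 ≤ ((⊤ : ℕ∞) : ℕ∞ω) := WithTop.coe_le_coe.mpr le_top
  have h1 : DifferentiableAt ℝ (fderiv ℝ f) x :=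
    ((hf x hx).fderiv_right (m := 1) h2le).differentiableAt one_ne_zero
  have h2 : DifferentiableAt ℝ (fderiv ℝ g) x :=
    ((hg x hx).fderiv_right (m := 1) h2le).differentiableAt one_ne_zero
  exact fderiv_add h1 h2

/-! ### The jets of hole 2 at the shell point, and the cancellation of its potential -/

section HoleTwo

variable {K M D d : ℝ} {c₂ x : E4}

/-- Powers of the inverse distance: `1/ρ^k ≤ 1/c^k` for `ρ ≥ c > 0`. [folklore] -/
theorem one_div_pow_le {ρ c : ℝ} (hc : 0 < c) (hρ : c ≤ ρ) (k : ℕ) : 1 / ρ ^ k ≤ 1 / c ^ k :=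
  one_div_le_one_div_of_le (pow_pos hc k) (pow_le_pow_left₀ hc.le hρ k)

/-- `K/ρ^k ≤ K (2/D)^k` for `ρ ≥ D/2 > 0`, `K ≥ 0`. [folklore] -/
theorem div_pow_le_half {K ρ D : ℝ} (hK : 0 ≤ K) (hD : 0 < D) (hρ : D / 2 ≤ ρ) (k : ℕ) :
    K / ρ ^ k ≤ K * (2 / D) ^ k := by
  have h := one_div_pow_le (by positivity : 0 < D / 2) hρ k
  calc K / ρ ^ k = K * (1 / ρ ^ k) := by ring
    _ ≤ K * (1 / (D / 2) ^ k) := by gcongr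
    _ = K * (2 / D) ^ k := by rw [one_div, ← inv_pow, inv_div]

/-- **The jets of hole 2 at the shell point** `x` (`‖c₂̲‖ = D ≥ 8‖x̲‖ > 0`, `x⁰ = 0`):
`‖h₂‖ ≤ 2K/D`, `‖Dh₂‖ ≤ 4K/D²`, `‖D²h₂‖ ≤ 8K/D³`; at hole 1's centre `‖h₂(0)‖ ≤ K/D`; and the
cancellation `‖h₂(x) − h₂(0)‖ ≤ 2K‖x̲‖/D²` (mean value on `B(0, 2‖x̲‖)`). [folklore] -/
theorem hole₂_jets (hK0 : 0 ≤ K)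
    (hK : ∀ y : E4, 0 < E4.spatialNorm (y - c₂) →
      ‖Kerr.bilin M 0 (y - c₂) - Minkowski.bilin‖ ≤ K / E4.spatialNorm (y - c₂) ∧
      ‖fderiv ℝ (fun z ↦ Kerr.bilin M 0 (z - c₂) - Minkowski.bilin) y‖ ≤
        K / E4.spatialNorm (y - c₂) ^ 2 ∧
      ‖fderiv ℝ (fderiv ℝ (fun z ↦ Kerr.bilin M 0 (z - c₂) - Minkowski.bilin)) y‖ ≤
        K / E4.spatialNorm (y - c₂) ^ 3)
    (hsmooth : ∀ y : E4, 0 < E4.spatialNorm (y - c₂) →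
      DifferentiableAt ℝ (fun z ↦ Kerr.bilin M 0 (z - c₂) - Minkowski.bilin) y)
    (hc : E4.spatialNorm c₂ = D) (hx0 : x 0 = 0) (hd : 0 < E4.spatialNorm x)
    (hD : 8 * E4.spatialNorm x ≤ D) :
    0 < E4.spatialNorm (x - c₂) ∧
    ‖Kerr.bilin M 0 (x - c₂) - Minkowski.bilin‖ ≤ 2 * K / D ∧
    ‖fderiv ℝ (fun z ↦ Kerr.bilin M 0 (z - c₂) - Minkowski.bilin) x‖ ≤ 4 * K / D ^ 2 ∧
    ‖fderiv ℝ (fderiv ℝ (fun z ↦ Kerr.bilin M 0 (z - c₂) - Minkowski.bilin)) x‖ ≤ 8 * K / D ^ 3 ∧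
    ‖Kerr.bilin M 0 (0 - c₂) - Minkowski.bilin‖ ≤ K / D ∧
    ‖(Kerr.bilin M 0 (x - c₂) - Minkowski.bilin) - (Kerr.bilin M 0 (0 - c₂) - Minkowski.bilin)‖ ≤
      2 * K * E4.spatialNorm x / D ^ 2 := by
  set d := E4.spatialNorm x with hdd
  have hD0 : 0 < D := by linarith
  have hρx : D / 2 ≤ E4.spatialNorm (x - c₂) := by
    have := spatialNorm_sub_far' (x := x) hc; linarith
  have hρx0 : 0 < E4.spatialNorm (x - c₂) := by linarith
  obtain ⟨j0, j1, j2⟩ := hK x hρx0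
  refine ⟨hρx0, ?_, ?_, ?_, ?_, ?_⟩
  · refine j0.trans ?_
    have h := div_pow_le_half hK0 hD0 hρx 1
    rw [pow_one, pow_one] at h
    calc _ ≤ K * (2 / D) := h
      _ = 2 * K / D := by ring
  · refine j1.trans ((div_pow_le_half hK0 hD0 hρx 2).trans (le_of_eq ?_))
    ring
  · refine j2.trans ((div_pow_le_half hK0 hD0 hρx 3).trans (le_of_eq ?_))
    ring
  · have h0 : E4.spatialNorm ((0 : E4) - c₂) = D := by rw [spatialNorm_sub_comm, sub_zero, hc]
    have := (hK 0 (by rw [h0]; exact hD0)).1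
    rwa [h0] at this
  · -- mean value on the ball `B(0, 2d)`, at spatial distance `≥ 3D/4` from hole 2
    have hfar : ∀ z ∈ ball (0 : E4) (2 * d), 3 * D / 4 ≤ E4.spatialNorm (z - c₂) := by
      intro z hz
      rw [mem_ball, dist_zero_right] at hz
      have := spatialNorm_sub_far (z := z) hc hz
      linarith
    have hdiff : ∀ z ∈ ball (0 : E4) (2 * d),
        DifferentiableAt ℝ (fun z ↦ Kerr.bilin M 0 (z - c₂) - Minkowski.bilin) z :=
      fun z hz ↦ hsmooth z (by linarith [hfar z hz])
    have hbound : ∀ z ∈ ball (0 : E4) (2 * d),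
        ‖fderiv ℝ (fun z ↦ Kerr.bilin M 0 (z - c₂) - Minkowski.bilin) z‖ ≤ 2 * K / D ^ 2 := by
      intro z hz
      have hρ0 : 0 < E4.spatialNorm (z - c₂) := by linarith [hfar z hz]
      have hq := one_div_pow_le (by positivity : 0 < 3 * D / 4) (hfar z hz) 2
      calc _ ≤ K / E4.spatialNorm (z - c₂) ^ 2 := (hK z hρ0).2.1
        _ = K * (1 / E4.spatialNorm (z - c₂) ^ 2) := by ring
        _ ≤ K * (1 / (3 * D / 4) ^ 2) := by gcongr
        _ = (16 / 9) * (K / D ^ 2) := by field_simp; try ring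
        _ ≤ 2 * (K / D ^ 2) := mul_le_mul_of_nonneg_right (by norm_num) (by positivity)
        _ = 2 * K / D ^ 2 := by ring
    have hxball : (0 : E4) + x ∈ ball (0 : E4) (2 * d) := by
      rw [zero_add, mem_ball, dist_zero_right, norm_eq_spatialNorm_of_apply_zero_eq_zero hx0]; linarith
    have hmvt := norm_sub_le_of_fderiv (convex_ball (0 : E4) (2 * d)) hdiff hbound
      (mem_ball_self (by positivity)) hxball
    rw [zero_add, zero_sub, norm_eq_spatialNorm_of_apply_zero_eq_zero hx0] at hmvt
    calc _ = ‖(Kerr.bilin M 0 (x - c₂) - Minkowski.bilin) - (Kerr.bilin M 0 (-c₂) - Minkowski.bilin)‖ := by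
          rw [zero_sub]
      _ ≤ 2 * K / D ^ 2 * d := hmvt
      _ = 2 * K * d / D ^ 2 := by ring

end HoleTwo

/-! ### Hole 1 on the ball `B(x, d/2)` -/

section HoleOne

variable {K M : ℝ} {x : E4}

/-- Points of `B(x, d/2)`, `d = ‖x̲‖`, have `‖z̲‖ > d/2`. [folklore] -/
theorem half_lt_spatialNorm_of_mem_ball {z : E4} (hz : z ∈ ball x (E4.spatialNorm x / 2)) :
    E4.spatialNorm x / 2 < E4.spatialNorm z := by
  rw [mem_ball, dist_eq_norm] at hz
  have h := spatialNorm_le_spatialNorm_add x z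
  rw [spatialNorm_sub_comm] at h
  linarith [E4.spatialNorm_le_norm (z - x)]

/-- **The jets of hole 1 on the ball `B(x, d/2)`**: from `‖Dᵐh₁(y)‖ ≤ K/‖y̲‖^{m+1}` off the axis,
`‖Dᵐh₁(z)‖ ≤ K (2/d)^{m+1}` on the ball (`m ≤ 4`), and `‖h₁(z)‖ ≤ 2K/d`. [folklore] -/
theorem hole₁_ball_jets (hK0 : 0 ≤ K)
    (hK : ∀ y : E4, 0 < E4.spatialNorm y →
      ‖Kerr.bilin M 0 y - Minkowski.bilin‖ ≤ K / E4.spatialNorm y ∧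
      ∀ m ≤ 4, ‖iteratedFDeriv ℝ m (fun z ↦ Kerr.bilin M 0 z - Minkowski.bilin) y‖ ≤
        K / E4.spatialNorm y ^ (m + 1))
    (hd : 0 < E4.spatialNorm x) {z : E4} (hz : z ∈ ball x (E4.spatialNorm x / 2)) :
    ‖Kerr.bilin M 0 z - Minkowski.bilin‖ ≤ 2 * K / E4.spatialNorm x ∧
    ∀ m ≤ 4, ‖iteratedFDeriv ℝ m (fun z ↦ Kerr.bilin M 0 z - Minkowski.bilin) z‖ ≤
      K * (2 / E4.spatialNorm x) ^ (m + 1) := by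
  have hz' := half_lt_spatialNorm_of_mem_ball hz
  have hz0 : 0 < E4.spatialNorm z := by linarith
  obtain ⟨j0, jm⟩ := hK z hz0
  refine ⟨?_, fun m hm ↦ ?_⟩
  · have h := div_pow_le_half hK0 hd hz'.le 1
    rw [pow_one, pow_one] at h
    calc _ ≤ K / E4.spatialNorm z := j0
      _ ≤ K * (2 / E4.spatialNorm x) := h
      _ = _ := by ring
  · exact (jm m hm).trans (div_pow_le_half hK0 hd hz'.le (m + 1))

/-- Hole 1 is `C^∞` on the ball `B(x, d/2)` (which misses the axis). [cite: KerrSchild1965, §3] -/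
theorem contDiffOn_hole₁_ball (M : ℝ) (hd : 0 < E4.spatialNorm x) :
    ContDiffOn ℝ ∞ (fun z ↦ Kerr.bilin M 0 z - Minkowski.bilin) (ball x (E4.spatialNorm x / 2)) := by
  intro z hz
  have hz0 : 0 < E4.spatialNorm z := by linarith [half_lt_spatialNorm_of_mem_ball hz]
  have hr : 0 < Kerr.radius 0 z := by rwa [Kerr.radius_zero_left]
  exact (Kerr.contDiffAt_ksPert (M := M) hr).contDiffWithinAt

/-- **The dragged shell point**: for `‖A‖ ≤ ¼` and `x⁰ = 0`, `x + Ax ∈ B(x, d/2)` and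
`‖(x + Ax)̲‖ ≥ d/2`, `‖Ax‖ ≤ ‖A‖ d` (`d = ‖x̲‖ > 0`). [folklore] -/
theorem drag_point (A : E4 →L[ℝ] E4) (hA : ‖A‖ ≤ 4⁻¹) (hx0 : x 0 = 0)
    (hd : 0 < E4.spatialNorm x) :
    ‖A x‖ ≤ ‖A‖ * E4.spatialNorm x ∧ x + A x ∈ ball x (E4.spatialNorm x / 2) ∧
      E4.spatialNorm x / 2 ≤ E4.spatialNorm (x + A x) := by
  have h1 : ‖A x‖ ≤ ‖A‖ * E4.spatialNorm x := by
    rw [← norm_eq_spatialNorm_of_apply_zero_eq_zero hx0]; exact le_opNorm _ _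
  have h2 : ‖A x‖ ≤ E4.spatialNorm x / 4 := by
    calc ‖A x‖ ≤ ‖A‖ * E4.spatialNorm x := h1
      _ ≤ 4⁻¹ * E4.spatialNorm x := by gcongr
      _ = _ := by ring
  refine ⟨h1, ?_, ?_⟩
  · rw [mem_ball, dist_eq_norm, add_sub_cancel_left]; linarith
  · linarith [spatialNorm_add_drag x (A x)]

end HoleOne

/-! ### All shell data at once -/

section Shell

/-- **The shell data of the drag-defect estimate** (`C ≥ 1`, positive masses, `‖c₂̲‖ = D`, `x⁰ = 0`,
`32 C² (M₁ + M₂) ≤ ‖x̲‖ = d`, `8d ≤ D`, `‖η⁻¹‖ ≤ 1`): scales, hole 2 at `x` with the cancellation of its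
potential, the potential's symmetry and the drag `A = ½η⁻¹c`, the dragged point, hole 1 on
`B(x, d/2)`. [folklore] -/
theorem shell_data {C M₁ M₂ D : ℝ} {c₂ x : E4} (hC1 : 1 ≤ C)
    (hKS : ∀ (M : ℝ) (c y : E4), 0 < E4.spatialNorm (y - c) →
      ‖Kerr.bilin M 0 (y - c) - Minkowski.bilin‖ ≤ C * |M| / E4.spatialNorm (y - c) ∧
      ‖fderiv ℝ (fun z ↦ Kerr.bilin M 0 (z - c) - Minkowski.bilin) y‖ ≤
        C * |M| / E4.spatialNorm (y - c) ^ 2 ∧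
      ‖fderiv ℝ (fderiv ℝ (fun z ↦ Kerr.bilin M 0 (z - c) - Minkowski.bilin)) y‖ ≤
        C * |M| / E4.spatialNorm (y - c) ^ 3 ∧
      ∀ m ≤ 4, ‖iteratedFDeriv ℝ m (fun z ↦ Kerr.bilin M 0 (z - c) - Minkowski.bilin) y‖ ≤
        C * |M| / E4.spatialNorm (y - c) ^ (m + 1))
    (hinv : ‖(Minkowski.bilin : E4 →L[ℝ] E4 →L[ℝ] ℝ).inverse‖ ≤ 1)
    (hM₁ : 0 < M₁) (hM₂ : 0 < M₂) (hc₂ : E4.spatialNorm c₂ = D) (hx0 : x 0 = 0)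
    (hsmall : 32 * C ^ 2 * (M₁ + M₂) ≤ E4.spatialNorm x) (hD : 8 * E4.spatialNorm x ≤ D) :
    (0 < E4.spatialNorm x ∧ 0 < D ∧ 32 * (C * (M₁ + M₂)) ≤ E4.spatialNorm x) ∧
    (0 < E4.spatialNorm (x - c₂) ∧
      ‖Kerr.bilin M₂ 0 (x - c₂) - Minkowski.bilin‖ ≤ 2 * (C * M₂) / D ∧
      ‖fderiv ℝ (fun z ↦ Kerr.bilin M₂ 0 (z - c₂) - Minkowski.bilin) x‖ ≤ 4 * (C * M₂) / D ^ 2 ∧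
      ‖fderiv ℝ (fderiv ℝ (fun z ↦ Kerr.bilin M₂ 0 (z - c₂) - Minkowski.bilin)) x‖ ≤
        8 * (C * M₂) / D ^ 3 ∧
      ‖Kerr.bilin M₂ 0 (0 - c₂) - Minkowski.bilin‖ ≤ C * M₂ / D ∧
      ‖(Kerr.bilin M₂ 0 (x - c₂) - Minkowski.bilin) - (Kerr.bilin M₂ 0 (0 - c₂) - Minkowski.bilin)‖ ≤
        2 * (C * M₂) * E4.spatialNorm x / D ^ 2) ∧
    ((∀ v w, (Kerr.bilin M₂ 0 (0 - c₂) - Minkowski.bilin) v w =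
        (Kerr.bilin M₂ 0 (0 - c₂) - Minkowski.bilin) w v) ∧
      ‖(2⁻¹ : ℝ) • ((Minkowski.bilin : E4 →L[ℝ] E4 →L[ℝ] ℝ).inverse.comp
        (Kerr.bilin M₂ 0 (0 - c₂) - Minkowski.bilin))‖ ≤ C * (M₁ + M₂) / (2 * D) ∧
      ‖(2⁻¹ : ℝ) • ((Minkowski.bilin : E4 →L[ℝ] E4 →L[ℝ] ℝ).inverse.comp
        (Kerr.bilin M₂ 0 (0 - c₂) - Minkowski.bilin))‖ ≤ 4⁻¹ ∧
      ‖((2⁻¹ : ℝ) • ((Minkowski.bilin : E4 →L[ℝ] E4 →L[ℝ] ℝ).inverse.comp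
        (Kerr.bilin M₂ 0 (0 - c₂) - Minkowski.bilin))) x‖ ≤
        ‖(2⁻¹ : ℝ) • ((Minkowski.bilin : E4 →L[ℝ] E4 →L[ℝ] ℝ).inverse.comp
          (Kerr.bilin M₂ 0 (0 - c₂) - Minkowski.bilin))‖ * E4.spatialNorm x ∧
      x + ((2⁻¹ : ℝ) • ((Minkowski.bilin : E4 →L[ℝ] E4 →L[ℝ] ℝ).inverse.comp
        (Kerr.bilin M₂ 0 (0 - c₂) - Minkowski.bilin))) x ∈ ball x (E4.spatialNorm x / 2) ∧
      0 < E4.spatialNorm (x + ((2⁻¹ : ℝ) • ((Minkowski.bilin : E4 →L[ℝ] E4 →L[ℝ] ℝ).inverse.comp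
        (Kerr.bilin M₂ 0 (0 - c₂) - Minkowski.bilin))) x)) ∧
    ((∀ z ∈ ball x (E4.spatialNorm x / 2),
        ‖Kerr.bilin M₁ 0 z - Minkowski.bilin‖ ≤ C * M₁ * (2 / E4.spatialNorm x)) ∧
      (∀ m ≤ 4, ∀ z ∈ ball x (E4.spatialNorm x / 2),
        ‖iteratedFDeriv ℝ m (fun z ↦ Kerr.bilin M₁ 0 z - Minkowski.bilin) z‖ ≤
          C * M₁ * (2 / E4.spatialNorm x) ^ (m + 1)) ∧
      ContDiffOn ℝ ∞ (fun z ↦ Kerr.bilin M₁ 0 z - Minkowski.bilin) (ball x (E4.spatialNorm x / 2))) := by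
  set d := E4.spatialNorm x with hdd
  set cst : E4 →L[ℝ] E4 →L[ℝ] ℝ := Kerr.bilin M₂ 0 (0 - c₂) - Minkowski.bilin with hcst
  set A : E4 →L[ℝ] E4 := (2⁻¹ : ℝ) • ((Minkowski.bilin : E4 →L[ℝ] E4 →L[ℝ] ℝ).inverse.comp cst)
    with hA
  -- scales
  have hC0 : 0 < C := one_pos.trans_le hC1
  have hm0 : 0 < M₁ + M₂ := add_pos hM₁ hM₂
  have hεd : 32 * (C * (M₁ + M₂)) ≤ d := by
    calc 32 * (C * (M₁ + M₂)) ≤ 32 * (C ^ 2 * (M₁ + M₂)) := by gcongr; nlinarith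
      _ = 32 * C ^ 2 * (M₁ + M₂) := by ring
      _ ≤ d := hsmall
  have hd0 : 0 < d := by
    have : 0 < 32 * (C * (M₁ + M₂)) := by positivity
    linarith
  have hD0 : 0 < D := by linarith
  have hK₂0 : 0 ≤ C * M₂ := by positivity
  have hK₁0 : 0 ≤ C * M₁ := by positivity
  -- hole 2
  have hKS₂ : ∀ y : E4, 0 < E4.spatialNorm (y - c₂) →
      ‖Kerr.bilin M₂ 0 (y - c₂) - Minkowski.bilin‖ ≤ C * M₂ / E4.spatialNorm (y - c₂) ∧
      ‖fderiv ℝ (fun z ↦ Kerr.bilin M₂ 0 (z - c₂) - Minkowski.bilin) y‖ ≤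
        C * M₂ / E4.spatialNorm (y - c₂) ^ 2 ∧
      ‖fderiv ℝ (fderiv ℝ (fun z ↦ Kerr.bilin M₂ 0 (z - c₂) - Minkowski.bilin)) y‖ ≤
        C * M₂ / E4.spatialNorm (y - c₂) ^ 3 := by
    intro y hy
    obtain ⟨j0, j1, j2, -⟩ := hKS M₂ c₂ y hy
    rw [abs_of_pos hM₂] at j0 j1 j2
    exact ⟨j0, j1, j2⟩
  have hsm₂ : ∀ y : E4, 0 < E4.spatialNorm (y - c₂) →
      DifferentiableAt ℝ (fun z ↦ Kerr.bilin M₂ 0 (z - c₂) - Minkowski.bilin) y := by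
    intro y hy
    have hr : 0 < Kerr.radius 0 (y - c₂) := by rwa [Kerr.radius_zero_left]
    exact ((Kerr.contDiffAt_ksPert (M := M₂) hr (n := ∞)).comp y
      (contDiff_id.sub contDiff_const).contDiffAt).differentiableAt (by simp)
  obtain ⟨hρx0, hq₀, hp₁, hp₂, hcstb, hcanc⟩ := hole₂_jets hK₂0 hKS₂ hsm₂ hc₂ hx0 hd0 hD
  -- the drag
  have hcst_symm : ∀ v w, cst v w = cst w v := fun v w ↦ by
    simp only [hcst, _root_.sub_apply]
    rw [Kerr.bilin_symm M₂ 0 _ v w, Minkowski.bilin_symm v w]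
  have ha : ‖A‖ ≤ C * (M₁ + M₂) / (2 * D) := by
    have h1 : ‖A‖ ≤ 2⁻¹ * ‖cst‖ := by
      rw [hA, norm_smul, Real.norm_eq_abs, abs_of_pos (by norm_num : (0 : ℝ) < 2⁻¹)]
      gcongr
      calc _ ≤ ‖(Minkowski.bilin : E4 →L[ℝ] E4 →L[ℝ] ℝ).inverse‖ * ‖cst‖ := opNorm_comp_le _ _
        _ ≤ 1 * ‖cst‖ := by gcongr
        _ = ‖cst‖ := one_mul _
    calc ‖A‖ ≤ 2⁻¹ * ‖cst‖ := h1
      _ ≤ 2⁻¹ * (C * M₂ / D) := by gcongr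
      _ ≤ 2⁻¹ * (C * (M₁ + M₂) / D) := by gcongr; nlinarith
      _ = C * (M₁ + M₂) / (2 * D) := by ring
  have ha4 : ‖A‖ ≤ 4⁻¹ := by
    refine ha.trans ?_
    rw [div_le_iff₀ (by positivity)]
    linarith
  obtain ⟨hAx, hxball, hρ₁⟩ := drag_point A ha4 hx0 hd0
  have hρ₁0 : 0 < E4.spatialNorm (x + A x) := by linarith
  -- hole 1 on the ball
  have hKS₁ : ∀ y : E4, 0 < E4.spatialNorm y →
      ‖Kerr.bilin M₁ 0 y - Minkowski.bilin‖ ≤ C * M₁ / E4.spatialNorm y ∧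
      ∀ m ≤ 4, ‖iteratedFDeriv ℝ m (fun z ↦ Kerr.bilin M₁ 0 z - Minkowski.bilin) y‖ ≤
        C * M₁ / E4.spatialNorm y ^ (m + 1) := by
    intro y hy
    have hy' : 0 < E4.spatialNorm (y - 0) := by rwa [sub_zero]
    obtain ⟨j0, -, -, jm⟩ := hKS M₁ 0 y hy'
    simp only [sub_zero, abs_of_pos hM₁] at j0 jm
    exact ⟨j0, jm⟩
  have hball := fun z (hz : z ∈ ball x (d / 2)) ↦ hole₁_ball_jets hK₁0 hKS₁ hd0 hz
  refine ⟨⟨hd0, hD0, hεd⟩, ⟨hρx0, hq₀, hp₁, hp₂, hcstb, hcanc⟩,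
    ⟨hcst_symm, ha, ha4, hAx, hxball, hρ₁0⟩, ⟨fun z hz ↦ ?_, fun m hm z hz ↦ (hball z hz).2 m hm,
    contDiffOn_hole₁_ball M₁ hd0⟩⟩
  have := (hball z hz).1
  convert this using 1; ring

/-- **Registered sub-goal form** (stub `dragDefect_fderiv_fderiv_add` of the crux item) of
`fderiv_fderiv_add_of_isOpen`. [folklore] -/
theorem dragDefect_fderiv_fderiv_add : ∀ {E F : Type*} [NormedAddCommGroup E] [NormedSpace ℝ E] [NormedAddCommGroup F] [NormedSpace ℝ F] {f g : E → F} {O : Set E}, IsOpen O → (∀ y ∈ O, ContDiffAt ℝ ((⊤ : ℕ∞) : WithTop ℕ∞) f y) → (∀ y ∈ O, ContDiffAt ℝ ((⊤ : ℕ∞) : WithTop ℕ∞) g y) → ∀ {x : E}, x ∈ O → fderiv ℝ (fderiv ℝ (fun y ↦ f y + g y)) x = fderiv ℝ (fderiv ℝ f) x + fderiv ℝ (fderiv ℝ g) x :=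
  fun hO hf hg _ hx ↦ fderiv_fderiv_add_of_isOpen hO hf hg hx

end Shell

end DragDefect

end Summit.FinalStateConjecture.FinalStateConjecture.Theorems

end
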